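import Mathlib
import Summits.NavierStokesRegularity.NavierStokesRegularity.Theorems.SubOnsagerCeilingSideBranchLiveBalance
import Summits.NavierStokesRegularity.NavierStokesRegularity.Theorems.SubOnsagerCeilingSideBranchChainDrive
import HarnessLib

/-!
# Route SubOnsagerCeiling — the FREE (non-pocket) block energy of `α_SB`: monotone, and drained at a
# POCKET-INDEPENDENT rate while a shell is on (Barbato–Flandoli–Morandin's dissipation step with a side drain)
# (helper file for item stmt-NavierStokesRegularity-25507 `OrthantTailCeiling`; `--supports`; def-free)

Toward a viscosity-uniform, pocket-independent anomalous-relaxation theorem for `α_SB = sideBranchTable`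
(census gap: «no anomalous-dissipation theorem for Katz–Pavlović networks with drains»).  The block relaxation
of record (p826753) needs a CAP on the pockets (its clock is the linger bound p825747).  BFM 2011, Lemma 7, relax
the bare chain pocket-free: while `x_n` is on, the receiver `x_{n+1}` is driven and drains the block.  For
`α_SB` the functional is the FREE BLOCK ENERGY `φ_K = B_K − P_K` (`B_K = Σ_{k≤K}Σ_i ½X_{i,k}²`,
`P_K = Σ_{k≤K} ½z_k²`) and shell `K` is «on» when `x_K² + s_K² ≥ ℓ`:
* `sideBranch_freeBlock_hasDeriv` — `φ_K` has a one-sided derivative `≤ −Π_K` (`Π_K` the bond flux; in-block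
  pocket feeds and dissipation only lower it), given `z_k ≥ 0` on the block;
* `sideBranch_freeBlock_antitone` — `φ_K` is non-increasing along non-negative solutions;
* **`sideBranch_freeBlock_window_drop`** — on `[t,t+h]` with `x_K²+s_K² ≥ ℓ ≥ 0`, receiver drains
  `x_{K+2}, s_{K+1} ≤ M`: `φ_K(t+h) ≤ φ_K(t) − e^{−λh}(Λ_Kℓh)²/52`, `λ = (6/5)Λ_{K+1}M + ν_{K+1}` — NO POCKET
  CAP: both receivers are driven, `x_{K+1}(u) ≥ e^{−λh}Λ_K∫_t^u x_K²`, `z_{K+1}(u) ≥ e^{−λh}(Λ_K/5)∫_t^u s_K²`,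
  so the drains integrate to `≥ e^{−λh}(H²+G²)/2` with `H + 5G ≥ Λ_Kℓh`.  With `M = √(2φ_∞(0))` (the drains
  are FREE modes) the step is scale-covariant — input for a `t⁻²` free-energy decay à la BFM Thm. 8 (not here).

HONEST FRAMING: elementary real analysis of a Tao-type MODEL lattice ODE (route SubOnsagerCeiling, rung
TL-M2Break); bricks toward a construction NOT carried out here; nothing bears on Navier–Stokes regularity;
no crux is settled here. [cite: Tao2016AveragedNS, §4 (4.2)–(4.3)]; [cite: BarbatoMorandinRomito2011, §2].
-/

noncomputable section

-- the sub-problem namespace `NavierStokesRegularity.NavierStokesRegularity` is the tree's layout (D-0017)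
set_option linter.dupNamespace false

namespace Summit.NavierStokesRegularity.NavierStokesRegularity.Theorems.SubOnsagerCeiling

open Set MeasureTheory intervalIntegral
open Literature.Analysis.FluidPDE.TaoCascade

section Solution

variable {ε₀ ν s : ℝ} {X : Fin 4 → ℤ → ℝ → ℝ}

/-- **The free block energy is drained at least by the bond flux**: at `u ∈ [0,s]` with the block's pockets
`≥ 0`, `φ_K = Σ_{k≤K}Σ_i ½X_{i,k}² − Σ_{k≤K} ½z_k²` has a one-sided derivative `d ≤ −Π_K(u)`. [this file] -/
theorem sideBranch_freeBlock_hasDeriv (hε : 0 < ε₀) (hν : 0 ≤ ν)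
    (hlow : ∀ (i : Fin 4) (k : ℤ), k < 0 → ∀ t : ℝ, X i k t = 0)
    (hder : ∀ (i : Fin 4) (k : ℤ), ∀ t ∈ Icc (0 : ℝ) s, HasDerivWithinAt (X i k)
      (quadTerm ε₀ sideBranchTable X i k t - ν * (1 + ε₀) ^ ((2 : ℝ) * k) * X i k t)
      (Icc (0 : ℝ) s) t)
    (K : ℕ) {u : ℝ} (hu : u ∈ Icc (0 : ℝ) s) (hz : ∀ k : ℕ, k ≤ K → 0 ≤ X 2 (k : ℤ) u) :
    ∃ d : ℝ, d ≤ -botSum ε₀ sideBranchTable X (K : ℤ) u ∧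
      HasDerivWithinAt
        (fun w => (∑ k ∈ Finset.range (K + 1), ∑ i : Fin 4, (1 / 2 : ℝ) * X i (k : ℤ) w ^ 2) -
          ∑ k ∈ Finset.range (K + 1), (1 / 2 : ℝ) * X 2 (k : ℤ) w ^ 2) d (Icc (0 : ℝ) s) u := by
  have hb : (0 : ℝ) < 1 + ε₀ := by linarith
  set c : ℤ → ℝ := fun k => ν * (1 + ε₀) ^ ((2 : ℝ) * (k : ℝ)) with hc
  have hc0 : ∀ k, 0 ≤ c k := fun k => mul_nonneg hν (Real.rpow_nonneg hb.le _)
  have hlive := sideBranch_liveBlock_hasDerivWithinAt hlow hder K hu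
  have hderS : HasDerivWithinAt (fun w => (1 / 2 : ℝ) * X 1 (K : ℤ) w ^ 2)
      (X 1 (K : ℤ) u * (quadTerm ε₀ sideBranchTable X 1 (K : ℤ) u -
        ν * (1 + ε₀) ^ ((2 : ℝ) * ((K : ℤ) : ℝ)) * X 1 (K : ℤ) u)) (Icc 0 s) u := by
    have h := ((hder 1 (K : ℤ) u hu).pow 2).const_mul (1 / 2 : ℝ)
    refine h.congr_deriv ?_
    rw [show (2 : ℕ) - 1 = 1 from rfl, pow_one]
    ring
  have hnegB : HasDerivWithinAt
      (fun w => -(∑ k ∈ Finset.range (K + 1), ∑ i : Fin 4, (1 / 2 : ℝ) * X i (k : ℤ) w ^ 2))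
      (botSum ε₀ sideBranchTable X (K : ℤ) u +
        ∑ k ∈ Finset.range (K + 1), ∑ i : Fin 4,
          ν * (1 + ε₀) ^ ((2 : ℝ) * ((k : ℤ) : ℝ)) * X i (k : ℤ) u ^ 2) (Icc 0 s) u := by
    have h := hlive.sub hderS
    refine (h.congr_of_eventuallyEq ?_ ?_).congr_deriv (by ring)
    · exact Filter.Eventually.of_forall fun w => by simp
    · simp
  have hP : HasDerivWithinAt (fun w => ∑ k ∈ Finset.range (K + 1), (1 / 2 : ℝ) * X 2 (k : ℤ) w ^ 2)
      (∑ k ∈ Finset.range (K + 1), X 2 (k : ℤ) u *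
        (quadTerm ε₀ sideBranchTable X 2 (k : ℤ) u - c k * X 2 (k : ℤ) u)) (Icc 0 s) u := by
    refine HasDerivWithinAt.fun_sum fun k _ => ?_
    have h := ((hder 2 (k : ℤ) u hu).pow 2).const_mul (1 / 2 : ℝ)
    refine h.congr_deriv ?_
    rw [show (2 : ℕ) - 1 = 1 from rfl, pow_one]
    simp only [hc]
    ring
  refine ⟨-(botSum ε₀ sideBranchTable X (K : ℤ) u +
      ∑ k ∈ Finset.range (K + 1), ∑ i : Fin 4,
        ν * (1 + ε₀) ^ ((2 : ℝ) * ((k : ℤ) : ℝ)) * X i (k : ℤ) u ^ 2) -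
      ∑ k ∈ Finset.range (K + 1), X 2 (k : ℤ) u *
        (quadTerm ε₀ sideBranchTable X 2 (k : ℤ) u - c k * X 2 (k : ℤ) u), ?_, ?_⟩
  · -- sign: pocket feeds `≥ 0`, dissipation of the pockets is inside `D_K`
    have hfeed : ∀ k ∈ Finset.range (K + 1),
        -(X 2 (k : ℤ) u * (quadTerm ε₀ sideBranchTable X 2 (k : ℤ) u - c k * X 2 (k : ℤ) u)) ≤
        ∑ i : Fin 4, ν * (1 + ε₀) ^ ((2 : ℝ) * ((k : ℤ) : ℝ)) * X i (k : ℤ) u ^ 2 := by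
      intro k hk
      have hkK : k ≤ K := Nat.lt_succ_iff.1 (Finset.mem_range.1 hk)
      rw [sideBranch_quadTerm_two]
      have hzk := hz k hkK
      have h1 : 0 ≤ X 2 (k : ℤ) u * ((1 / 5 : ℝ) * (1 + ε₀) ^ ((5 : ℝ) * (((k : ℤ) : ℝ) - 1) / 2) *
          X 1 ((k : ℤ) - 1) u ^ 2) :=
        mul_nonneg hzk (mul_nonneg (mul_nonneg (by norm_num) (Real.rpow_nonneg hb.le _)) (sq_nonneg _))
      have h2 : ν * (1 + ε₀) ^ ((2 : ℝ) * ((k : ℤ) : ℝ)) * X 2 (k : ℤ) u ^ 2 ≤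
          ∑ i : Fin 4, ν * (1 + ε₀) ^ ((2 : ℝ) * ((k : ℤ) : ℝ)) * X i (k : ℤ) u ^ 2 :=
        Finset.single_le_sum (f := fun i => ν * (1 + ε₀) ^ ((2 : ℝ) * ((k : ℤ) : ℝ)) * X i (k : ℤ) u ^ 2)
          (fun i _ => mul_nonneg (hc0 k) (sq_nonneg _)) (Finset.mem_univ (2 : Fin 4))
      have h3 : -(X 2 (k : ℤ) u * ((1 / 5 : ℝ) * (1 + ε₀) ^ ((5 : ℝ) * (((k : ℤ) : ℝ) - 1) / 2) *
          X 1 ((k : ℤ) - 1) u ^ 2 - c k * X 2 (k : ℤ) u)) =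
          -(X 2 (k : ℤ) u * ((1 / 5 : ℝ) * (1 + ε₀) ^ ((5 : ℝ) * (((k : ℤ) : ℝ) - 1) / 2) *
          X 1 ((k : ℤ) - 1) u ^ 2)) + ν * (1 + ε₀) ^ ((2 : ℝ) * ((k : ℤ) : ℝ)) * X 2 (k : ℤ) u ^ 2 := by
        simp only [hc]; ring
      rw [h3]
      linarith
    have hsum := Finset.sum_le_sum hfeed
    rw [Finset.sum_neg_distrib] at hsum
    linarith
  · have h := hnegB.neg.sub hP
    refine (h.congr_of_eventuallyEq ?_ ?_).congr_deriv (by ring)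
    · exact Filter.Eventually.of_forall fun w => by simp
    · simp

/-- **The free block energy is non-increasing** along non-negative regular solutions (`0 ≤ u₁ ≤ u₂ ≤ s`).
[this file] -/
theorem sideBranch_freeBlock_antitone (hε : 0 < ε₀) (hν : 0 ≤ ν)
    (hlow : ∀ (i : Fin 4) (k : ℤ), k < 0 → ∀ t : ℝ, X i k t = 0)
    (hder : ∀ (i : Fin 4) (k : ℤ), ∀ t ∈ Icc (0 : ℝ) s, HasDerivWithinAt (X i k)
      (quadTerm ε₀ sideBranchTable X i k t - ν * (1 + ε₀) ^ ((2 : ℝ) * k) * X i k t)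
      (Icc (0 : ℝ) s) t)
    (hpos : ∀ t ∈ Icc (0 : ℝ) s, ∀ (i : Fin 4) (k : ℤ), 0 ≤ k → 0 ≤ X i k t)
    (K : ℕ) {u₁ u₂ : ℝ} (hu₁ : 0 ≤ u₁) (hu : u₁ ≤ u₂) (hu₂ : u₂ ≤ s) :
    (∑ k ∈ Finset.range (K + 1), ∑ i : Fin 4, (1 / 2 : ℝ) * X i (k : ℤ) u₂ ^ 2) -
        ∑ k ∈ Finset.range (K + 1), (1 / 2 : ℝ) * X 2 (k : ℤ) u₂ ^ 2 ≤
      (∑ k ∈ Finset.range (K + 1), ∑ i : Fin 4, (1 / 2 : ℝ) * X i (k : ℤ) u₁ ^ 2) -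
        ∑ k ∈ Finset.range (K + 1), (1 / 2 : ℝ) * X 2 (k : ℤ) u₁ ^ 2 := by
  have hb : (0 : ℝ) < 1 + ε₀ := by linarith
  have hsub : Icc u₁ u₂ ⊆ Icc (0 : ℝ) s := Icc_subset_Icc hu₁ hu₂
  have hex : ∀ w ∈ Icc (0 : ℝ) s, ∃ d : ℝ, d ≤ -botSum ε₀ sideBranchTable X (K : ℤ) w ∧
      HasDerivWithinAt
        (fun w => (∑ k ∈ Finset.range (K + 1), ∑ i : Fin 4, (1 / 2 : ℝ) * X i (k : ℤ) w ^ 2) -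
          ∑ k ∈ Finset.range (K + 1), (1 / 2 : ℝ) * X 2 (k : ℤ) w ^ 2) d (Icc (0 : ℝ) s) w :=
    fun w hw => sideBranch_freeBlock_hasDeriv hε hν hlow hder K hw
      (fun k _ => hpos w hw 2 (k : ℤ) (by positivity))
  choose! d hd using hex
  set Φ : ℝ → ℝ := fun w => -((∑ k ∈ Finset.range (K + 1), ∑ i : Fin 4, (1 / 2 : ℝ) * X i (k : ℤ) w ^ 2) -
    ∑ k ∈ Finset.range (K + 1), (1 / 2 : ℝ) * X 2 (k : ℤ) w ^ 2) with hΦ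
  have hderΦ : ∀ w ∈ Icc u₁ u₂, HasDerivWithinAt Φ (-d w) (Icc u₁ u₂) w :=
    fun w hw => ((hd w (hsub hw)).2.mono hsub).neg
  have hnn : ∀ w ∈ Icc u₁ u₂, 0 ≤ -d w := by
    intro w hw
    have hw' := hsub hw
    have h1 := (hd w hw').1
    have hPi : 0 ≤ botSum ε₀ sideBranchTable X (K : ℤ) w := by
      rw [sideBranch_botSum]
      have h2 := hpos w hw' 0 ((K : ℤ) + 1) (by positivity)
      have h3 := hpos w hw' 2 ((K : ℤ) + 1) (by positivity)
      positivity
    linarith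
  have h := sideBranch_le_of_deriv_nonneg hderΦ hnn (right_mem_Icc.2 hu)
  simp only [hΦ] at h
  linarith
set_option maxHeartbeats 400000 in -- buildfix (bf3-g31): 160k/180k FAIL, 200k PASS at accept time; line-neutral budget line
/-- **The dissipation step (pocket-independent).** Non-negative regular solution on `[0,s]`, window
`[t,t+h] ⊆ [0,s]`, receiver drains `x_{K+2}, s_{K+1} ≤ M` (`M ≥ 0`), shell `K` on: `ℓ ≤ x_K² + s_K²` (`ℓ ≥ 0`).
Then `φ_K(t+h) ≤ φ_K(t) − e^{−λh}(Λ_Kℓh)²/52`, `λ = (6/5)Λ_{K+1}M + ν_{K+1}`; no pocket cap. [this file] -/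
theorem sideBranch_freeBlock_window_drop (hε : 0 < ε₀) (hν : 0 ≤ ν)
    (hlow : ∀ (i : Fin 4) (k : ℤ), k < 0 → ∀ t : ℝ, X i k t = 0)
    (hcont : ∀ (i : Fin 4) (k : ℤ), Continuous (X i k))
    (hder : ∀ (i : Fin 4) (k : ℤ), ∀ t ∈ Icc (0 : ℝ) s, HasDerivWithinAt (X i k)
      (quadTerm ε₀ sideBranchTable X i k t - ν * (1 + ε₀) ^ ((2 : ℝ) * k) * X i k t)
      (Icc (0 : ℝ) s) t)
    (hpos : ∀ t ∈ Icc (0 : ℝ) s, ∀ (i : Fin 4) (k : ℤ), 0 ≤ k → 0 ≤ X i k t)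
    (K : ℕ) {t h M ℓ : ℝ} (ht : 0 ≤ t) (hh : 0 < h) (hths : t + h ≤ s) (hM : 0 ≤ M) (hℓ : 0 ≤ ℓ)
    (hx2 : ∀ u ∈ Icc t (t + h), X 0 ((K : ℤ) + 1 + 1) u ≤ M)
    (hs1 : ∀ u ∈ Icc t (t + h), X 1 ((K : ℤ) + 1) u ≤ M)
    (hon : ∀ u ∈ Icc t (t + h), ℓ ≤ X 0 (K : ℤ) u ^ 2 + X 1 (K : ℤ) u ^ 2) :
    (∑ k ∈ Finset.range (K + 1), ∑ i : Fin 4, (1 / 2 : ℝ) * X i (k : ℤ) (t + h) ^ 2) -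
        ∑ k ∈ Finset.range (K + 1), (1 / 2 : ℝ) * X 2 (k : ℤ) (t + h) ^ 2 ≤
      (∑ k ∈ Finset.range (K + 1), ∑ i : Fin 4, (1 / 2 : ℝ) * X i (k : ℤ) t ^ 2) -
        (∑ k ∈ Finset.range (K + 1), (1 / 2 : ℝ) * X 2 (k : ℤ) t ^ 2) -
        Real.exp (-(((6 / 5 : ℝ) * (1 + ε₀) ^ ((5 : ℝ) * (((K : ℤ) + 1 : ℤ) : ℝ) / 2) * M +
          ν * (1 + ε₀) ^ ((2 : ℝ) * (((K : ℤ) + 1 : ℤ) : ℝ))) * h)) *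
          ((1 + ε₀) ^ ((5 : ℝ) * ((K : ℤ) : ℝ) / 2) * ℓ * h) ^ 2 / 52 := by
  have hb : (0 : ℝ) < 1 + ε₀ := by linarith
  set Λ : ℝ := (1 + ε₀) ^ ((5 : ℝ) * ((K : ℤ) : ℝ) / 2) with hΛ
  set Λ₁ : ℝ := (1 + ε₀) ^ ((5 : ℝ) * (((K : ℤ) + 1 : ℤ) : ℝ) / 2) with hΛ₁
  set c₁ : ℝ := ν * (1 + ε₀) ^ ((2 : ℝ) * (((K : ℤ) + 1 : ℤ) : ℝ)) with hc₁
  have hΛ0 : 0 < Λ := Real.rpow_pos_of_pos hb _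
  have hΛ₁0 : 0 < Λ₁ := Real.rpow_pos_of_pos hb _
  have hc₁0 : 0 ≤ c₁ := mul_nonneg hν (Real.rpow_nonneg hb.le _)
  set lam : ℝ := (6 / 5 : ℝ) * Λ₁ * M + c₁ with hlam
  have hlam0 : 0 ≤ lam := by positivity
  have hc₁lam : c₁ ≤ lam := by
    have h60 : 0 ≤ (6 / 5 : ℝ) * Λ₁ * M := by positivity
    rw [hlam]; linarith
  have hsub : Icc t (t + h) ⊆ Icc (0 : ℝ) s := Icc_subset_Icc ht hths
  set q : ℝ := Real.exp (-(lam * h)) with hq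
  have hq0 : 0 < q := Real.exp_pos _
  have hq1 : q ≤ 1 := by rw [hq]; exact Real.exp_le_one_iff.2 (by nlinarith)
  have hx2c : Continuous fun u => Λ * X 0 (K : ℤ) u ^ 2 := ((hcont 0 (K : ℤ)).pow 2).const_mul Λ
  have hs2c : Continuous fun u => (1 / 5 : ℝ) * Λ * X 1 (K : ℤ) u ^ 2 :=
    ((hcont 1 (K : ℤ)).pow 2).const_mul _
  set H : ℝ → ℝ := fun u => ∫ x in t..u, Λ * X 0 (K : ℤ) x ^ 2 with hH
  set G : ℝ → ℝ := fun u => ∫ x in t..u, (1 / 5 : ℝ) * Λ * X 1 (K : ℤ) x ^ 2 with hG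
  have hHd : ∀ u ∈ Icc t (t + h), HasDerivWithinAt H (Λ * X 0 (K : ℤ) u ^ 2) (Icc t (t + h)) u :=
    fun u _ => ((hx2c.integral_hasStrictDerivAt t u).hasDerivAt).hasDerivWithinAt
  have hGd : ∀ u ∈ Icc t (t + h), HasDerivWithinAt G ((1 / 5 : ℝ) * Λ * X 1 (K : ℤ) u ^ 2)
      (Icc t (t + h)) u :=
    fun u _ => ((hs2c.integral_hasStrictDerivAt t u).hasDerivAt).hasDerivWithinAt
  have hH0 : ∀ u ∈ Icc t (t + h), 0 ≤ H u := fun u hu =>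
    intervalIntegral.integral_nonneg hu.1 fun x _ => by positivity
  have hG0 : ∀ u ∈ Icc t (t + h), 0 ≤ G u := fun u hu =>
    intervalIntegral.integral_nonneg hu.1 fun x _ => by positivity
  have hfeed : (1 + ε₀) ^ ((5 : ℝ) * ((((K : ℤ) + 1 : ℤ) : ℝ) - 1) / 2) = Λ := by
    rw [hΛ]; push_cast; ring_nf
  have hxd : ∀ u ∈ Icc t (t + h), HasDerivWithinAt (X 0 ((K : ℤ) + 1))
      (quadTerm ε₀ sideBranchTable X 0 ((K : ℤ) + 1) u - c₁ * X 0 ((K : ℤ) + 1) u) (Icc t (t + h)) u :=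
    fun u hu => (hder 0 ((K : ℤ) + 1) u (hsub hu)).mono hsub
  have hxlow : ∀ u ∈ Icc t (t + h), Λ * X 0 (K : ℤ) u ^ 2 - lam * X 0 ((K : ℤ) + 1) u ≤
      quadTerm ε₀ sideBranchTable X 0 ((K : ℤ) + 1) u - c₁ * X 0 ((K : ℤ) + 1) u := by
    intro u hu
    have hu' := hsub hu
    rw [sideBranch_quadTerm_zero, hfeed, ← hΛ₁, add_sub_cancel_right]
    have hy := hpos u hu' 0 ((K : ℤ) + 1) (by positivity)
    have h1 : X 0 ((K : ℤ) + 1) u * X 0 ((K : ℤ) + 1 + 1) u ≤ X 0 ((K : ℤ) + 1) u * M :=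
      mul_le_mul_of_nonneg_left (hx2 u hu) hy
    have h2 : X 0 ((K : ℤ) + 1) u * X 1 ((K : ℤ) + 1) u ≤ X 0 ((K : ℤ) + 1) u * M :=
      mul_le_mul_of_nonneg_left (hs1 u hu) hy
    have h4 : Λ₁ * (X 0 ((K : ℤ) + 1) u * X 0 ((K : ℤ) + 1 + 1) u) ≤ Λ₁ * (X 0 ((K : ℤ) + 1) u * M) :=
      mul_le_mul_of_nonneg_left h1 hΛ₁0.le
    have h5 : (1 / 5 : ℝ) * Λ₁ * (X 0 ((K : ℤ) + 1) u * X 1 ((K : ℤ) + 1) u) ≤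
        (1 / 5 : ℝ) * Λ₁ * (X 0 ((K : ℤ) + 1) u * M) := mul_le_mul_of_nonneg_left h2 (by positivity)
    have h6 : lam * X 0 ((K : ℤ) + 1) u = Λ₁ * (X 0 ((K : ℤ) + 1) u * M) +
        (1 / 5 : ℝ) * Λ₁ * (X 0 ((K : ℤ) + 1) u * M) + c₁ * X 0 ((K : ℤ) + 1) u := by rw [hlam]; ring
    linarith
  have hdrive1 : ∀ u ∈ Icc t (t + h), H u ≤ Real.exp (lam * (u - t)) * X 0 ((K : ℤ) + 1) u := by
    intro u hu
    set Ψ : ℝ → ℝ := fun w => Real.exp (lam * (w - t)) * X 0 ((K : ℤ) + 1) w - H w with hΨ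
    have hderΨ : ∀ w ∈ Icc t (t + h), HasDerivWithinAt Ψ
        (Real.exp (lam * (w - t)) * (lam * 1) * X 0 ((K : ℤ) + 1) w +
          Real.exp (lam * (w - t)) * (quadTerm ε₀ sideBranchTable X 0 ((K : ℤ) + 1) w -
            c₁ * X 0 ((K : ℤ) + 1) w) - Λ * X 0 (K : ℤ) w ^ 2) (Icc t (t + h)) w := by
      intro w hw
      have hE : HasDerivWithinAt (fun w => Real.exp (lam * (w - t)))
          (Real.exp (lam * (w - t)) * (lam * 1)) (Icc t (t + h)) w :=
        (((hasDerivWithinAt_id w _).sub_const t).const_mul lam).exp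
      exact (hE.mul (hxd w hw)).sub (hHd w hw)
    have hnn : ∀ w ∈ Icc t (t + h), 0 ≤ Real.exp (lam * (w - t)) * (lam * 1) * X 0 ((K : ℤ) + 1) w +
        Real.exp (lam * (w - t)) * (quadTerm ε₀ sideBranchTable X 0 ((K : ℤ) + 1) w -
          c₁ * X 0 ((K : ℤ) + 1) w) - Λ * X 0 (K : ℤ) w ^ 2 := by
      intro w hw
      have hE1 : 1 ≤ Real.exp (lam * (w - t)) := Real.one_le_exp (by nlinarith [hw.1])
      have h1 := hxlow w hw
      have h2 : 0 ≤ Λ * X 0 (K : ℤ) w ^ 2 := by positivity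
      have h3 : Real.exp (lam * (w - t)) * (Λ * X 0 (K : ℤ) w ^ 2 - lam * X 0 ((K : ℤ) + 1) w) ≤
          Real.exp (lam * (w - t)) * (quadTerm ε₀ sideBranchTable X 0 ((K : ℤ) + 1) w -
            c₁ * X 0 ((K : ℤ) + 1) w) := mul_le_mul_of_nonneg_left h1 (Real.exp_pos _).le
      nlinarith
    have hmono := sideBranch_le_of_deriv_nonneg hderΨ hnn hu
    simp only [hΨ, hH, sub_self, mul_zero, Real.exp_zero, one_mul, integral_same, sub_zero] at hmono
    have hy0 := hpos t (hsub (left_mem_Icc.2 (by linarith))) 0 ((K : ℤ) + 1) (by positivity)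
    linarith
  have hzd : ∀ u ∈ Icc t (t + h), HasDerivWithinAt (X 2 ((K : ℤ) + 1))
      ((1 / 5 : ℝ) * Λ * X 1 (K : ℤ) u ^ 2 - c₁ * X 2 ((K : ℤ) + 1) u) (Icc t (t + h)) u := by
    intro u hu
    have h0 := (hder 2 ((K : ℤ) + 1) u (hsub hu)).mono hsub
    rw [sideBranch_quadTerm_two_succ, ← hΛ] at h0
    exact h0
  have hdrive2 : ∀ u ∈ Icc t (t + h), G u ≤ Real.exp (c₁ * (u - t)) * X 2 ((K : ℤ) + 1) u := by
    intro u hu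
    set Ψ : ℝ → ℝ := fun w => Real.exp (c₁ * (w - t)) * X 2 ((K : ℤ) + 1) w - G w with hΨ
    have hderΨ : ∀ w ∈ Icc t (t + h), HasDerivWithinAt Ψ
        (Real.exp (c₁ * (w - t)) * (c₁ * 1) * X 2 ((K : ℤ) + 1) w +
          Real.exp (c₁ * (w - t)) * ((1 / 5 : ℝ) * Λ * X 1 (K : ℤ) w ^ 2 - c₁ * X 2 ((K : ℤ) + 1) w) -
          (1 / 5 : ℝ) * Λ * X 1 (K : ℤ) w ^ 2) (Icc t (t + h)) w := by
      intro w hw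
      have hE : HasDerivWithinAt (fun w => Real.exp (c₁ * (w - t)))
          (Real.exp (c₁ * (w - t)) * (c₁ * 1)) (Icc t (t + h)) w :=
        (((hasDerivWithinAt_id w _).sub_const t).const_mul c₁).exp
      exact (hE.mul (hzd w hw)).sub (hGd w hw)
    have hnn : ∀ w ∈ Icc t (t + h), 0 ≤ Real.exp (c₁ * (w - t)) * (c₁ * 1) * X 2 ((K : ℤ) + 1) w +
        Real.exp (c₁ * (w - t)) * ((1 / 5 : ℝ) * Λ * X 1 (K : ℤ) w ^ 2 - c₁ * X 2 ((K : ℤ) + 1) w) -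
        (1 / 5 : ℝ) * Λ * X 1 (K : ℤ) w ^ 2 := by
      intro w hw
      have hE1 : 1 ≤ Real.exp (c₁ * (w - t)) := Real.one_le_exp (by nlinarith [hw.1])
      have h2 : 0 ≤ (1 / 5 : ℝ) * Λ * X 1 (K : ℤ) w ^ 2 := by positivity
      nlinarith
    have hmono := sideBranch_le_of_deriv_nonneg hderΨ hnn hu
    simp only [hΨ, hG, sub_self, mul_zero, Real.exp_zero, one_mul, integral_same, sub_zero] at hmono
    have hz0 := hpos t (hsub (left_mem_Icc.2 (by linarith))) 2 ((K : ℤ) + 1) (by positivity)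
    linarith
  have hxq : ∀ u ∈ Icc t (t + h), q * H u ≤ X 0 ((K : ℤ) + 1) u := by
    intro u hu
    have h1 := hdrive1 u hu
    have hE : 0 < Real.exp (lam * (u - t)) := Real.exp_pos _
    have hEle : Real.exp (lam * (u - t)) ≤ Real.exp (lam * h) :=
      Real.exp_le_exp.2 (by nlinarith [hu.2])
    have hy := hpos u (hsub hu) 0 ((K : ℤ) + 1) (by positivity)
    have h2 : H u ≤ Real.exp (lam * h) * X 0 ((K : ℤ) + 1) u :=
      h1.trans (mul_le_mul_of_nonneg_right hEle hy)
    have h3 : q * Real.exp (lam * h) = 1 := by rw [hq, ← Real.exp_add]; simp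
    calc q * H u ≤ q * (Real.exp (lam * h) * X 0 ((K : ℤ) + 1) u) := mul_le_mul_of_nonneg_left h2 hq0.le
      _ = X 0 ((K : ℤ) + 1) u := by rw [← mul_assoc, h3, one_mul]
  have hzq : ∀ u ∈ Icc t (t + h), q * G u ≤ X 2 ((K : ℤ) + 1) u := by
    intro u hu
    have h1 := hdrive2 u hu
    have hEle : Real.exp (c₁ * (u - t)) ≤ Real.exp (lam * h) :=
      Real.exp_le_exp.2 (by nlinarith [hu.1, hu.2])
    have hz := hpos u (hsub hu) 2 ((K : ℤ) + 1) (by positivity)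
    have h2 : G u ≤ Real.exp (lam * h) * X 2 ((K : ℤ) + 1) u :=
      h1.trans (mul_le_mul_of_nonneg_right hEle hz)
    have h3 : q * Real.exp (lam * h) = 1 := by rw [hq, ← Real.exp_add]; simp
    calc q * G u ≤ q * (Real.exp (lam * h) * X 2 ((K : ℤ) + 1) u) := mul_le_mul_of_nonneg_left h2 hq0.le
      _ = X 2 ((K : ℤ) + 1) u := by rw [← mul_assoc, h3, one_mul]
  have hex : ∀ w ∈ Icc (0 : ℝ) s, ∃ d : ℝ, d ≤ -botSum ε₀ sideBranchTable X (K : ℤ) w ∧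
      HasDerivWithinAt
        (fun w => (∑ k ∈ Finset.range (K + 1), ∑ i : Fin 4, (1 / 2 : ℝ) * X i (k : ℤ) w ^ 2) -
          ∑ k ∈ Finset.range (K + 1), (1 / 2 : ℝ) * X 2 (k : ℤ) w ^ 2) d (Icc (0 : ℝ) s) w :=
    fun w hw => sideBranch_freeBlock_hasDeriv hε hν hlow hder K hw
      (fun k _ => hpos w hw 2 (k : ℤ) (by positivity))
  choose! d hd using hex
  set φ : ℝ → ℝ := fun w => (∑ k ∈ Finset.range (K + 1), ∑ i : Fin 4, (1 / 2 : ℝ) * X i (k : ℤ) w ^ 2) -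
    ∑ k ∈ Finset.range (K + 1), (1 / 2 : ℝ) * X 2 (k : ℤ) w ^ 2 with hφ
  set Ψ : ℝ → ℝ := fun w => φ t - φ w - q * (H w ^ 2 / 2 + G w ^ 2 / 2) with hΨ
  have hderΨ : ∀ w ∈ Icc t (t + h), HasDerivWithinAt Ψ
      (-d w - q * (H w * (Λ * X 0 (K : ℤ) w ^ 2) + G w * ((1 / 5 : ℝ) * Λ * X 1 (K : ℤ) w ^ 2)))
      (Icc t (t + h)) w := by
    intro w hw
    have h1 := ((hd w (hsub hw)).2.mono hsub).const_sub (φ t)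
    have h2 : HasDerivWithinAt (fun w => H w ^ 2 / 2 + G w ^ 2 / 2)
        (H w * (Λ * X 0 (K : ℤ) w ^ 2) + G w * ((1 / 5 : ℝ) * Λ * X 1 (K : ℤ) w ^ 2)) (Icc t (t + h)) w := by
      have hA := ((hHd w hw).pow 2).div_const 2
      have hB := ((hGd w hw).pow 2).div_const 2
      refine (hA.add hB).congr_deriv ?_
      simp only [Nat.cast_ofNat]
      ring
    exact h1.sub (h2.const_mul q)
  have hnn : ∀ w ∈ Icc t (t + h),
      0 ≤ -d w - q * (H w * (Λ * X 0 (K : ℤ) w ^ 2) + G w * ((1 / 5 : ℝ) * Λ * X 1 (K : ℤ) w ^ 2)) := by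
    intro w hw
    have h1 := (hd w (hsub hw)).1
    rw [sideBranch_botSum, ← hΛ] at h1
    have h2 := hxq w hw
    have h3 := hzq w hw
    have h4 : 0 ≤ Λ * X 0 (K : ℤ) w ^ 2 := by positivity
    have h5 : 0 ≤ (1 / 5 : ℝ) * Λ * X 1 (K : ℤ) w ^ 2 := by positivity
    have h6 : q * (H w * (Λ * X 0 (K : ℤ) w ^ 2)) ≤ X 0 ((K : ℤ) + 1) w * (Λ * X 0 (K : ℤ) w ^ 2) := by
      rw [← mul_assoc]; exact mul_le_mul_of_nonneg_right h2 h4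
    have h7 : q * (G w * ((1 / 5 : ℝ) * Λ * X 1 (K : ℤ) w ^ 2)) ≤
        X 2 ((K : ℤ) + 1) w * ((1 / 5 : ℝ) * Λ * X 1 (K : ℤ) w ^ 2) := by
      rw [← mul_assoc]; exact mul_le_mul_of_nonneg_right h3 h5
    nlinarith
  have hmono := sideBranch_le_of_deriv_nonneg hderΨ hnn (right_mem_Icc.2 (by linarith))
  have hHt : H t = 0 := by simp only [hH, intervalIntegral.integral_same]
  have hGt : G t = 0 := by simp only [hG, intervalIntegral.integral_same]
  have h0 := hmono
  simp only [hΨ, hHt, hGt] at h0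
  norm_num at h0
  have hthh : t ≤ t + h := by linarith
  have hsum : Λ * ℓ * h ≤ H (t + h) + 5 * G (t + h) := by
    have h1 : H (t + h) + 5 * G (t + h) = ∫ x in t..(t + h), Λ * (X 0 (K : ℤ) x ^ 2 + X 1 (K : ℤ) x ^ 2) := by
      show (∫ x in t..(t + h), Λ * X 0 (K : ℤ) x ^ 2) + 5 * (∫ x in t..(t + h), (1 / 5 : ℝ) * Λ * X 1 (K : ℤ) x ^ 2) = _
      rw [← intervalIntegral.integral_const_mul,
        ← intervalIntegral.integral_add (hx2c.intervalIntegrable _ _)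
          ((hs2c.const_mul 5).intervalIntegrable _ _)]
      refine intervalIntegral.integral_congr fun x _ => ?_
      show Λ * X 0 (K : ℤ) x ^ 2 + 5 * ((1 / 5 : ℝ) * Λ * X 1 (K : ℤ) x ^ 2) =
        Λ * (X 0 (K : ℤ) x ^ 2 + X 1 (K : ℤ) x ^ 2)
      ring
    have hic : IntervalIntegrable (fun x => Λ * (X 0 (K : ℤ) x ^ 2 + X 1 (K : ℤ) x ^ 2))
        MeasureTheory.volume t (t + h) :=
      ((((hcont 0 (K : ℤ)).pow 2).add ((hcont 1 (K : ℤ)).pow 2)).const_mul Λ).intervalIntegrable _ _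
    have h2 : (∫ _ in t..(t + h), Λ * ℓ) ≤ ∫ x in t..(t + h), Λ * (X 0 (K : ℤ) x ^ 2 + X 1 (K : ℤ) x ^ 2) :=
      intervalIntegral.integral_mono_on hthh intervalIntegrable_const hic
        fun x hx => mul_le_mul_of_nonneg_left (hon x hx) hΛ0.le
    rw [intervalIntegral.integral_const, smul_eq_mul] at h2
    rw [h1]
    have h3 : (t + h - t) * (Λ * ℓ) = Λ * ℓ * h := by ring
    linarith only [h2, h3]
  have hcs26 : ∀ a b : ℝ, (a + 5 * b) ^ 2 ≤ 26 * (a ^ 2 + b ^ 2) := fun a b => by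
    nlinarith only [sq_nonneg (5 * a - b)]
  have hΛℓh : 0 ≤ Λ * ℓ * h := by positivity
  clear hderΨ hnn hmono hHt hGt
  clear_value Ψ H G q lam Λ₁ c₁ Λ φ
  have hmono' : φ (t + h) ≤ φ t - q * (H (t + h) ^ 2 / 2 + G (t + h) ^ 2 / 2) := by linarith only [h0]
  have hcs := hcs26 (H (t + h)) (G (t + h))
  have hsq : (Λ * ℓ * h) ^ 2 ≤ 26 * (H (t + h) ^ 2 + G (t + h) ^ 2) :=
    (pow_le_pow_left₀ hΛℓh hsum 2).trans hcs
  have hfin : q * (Λ * ℓ * h) ^ 2 / 52 ≤ q * (H (t + h) ^ 2 / 2 + G (t + h) ^ 2 / 2) := by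
    have h1 : q * (Λ * ℓ * h) ^ 2 / 52 = q * ((Λ * ℓ * h) ^ 2 / 52) := by ring
    rw [h1]
    exact mul_le_mul_of_nonneg_left (by linarith only [hsq]) hq0.le
  have key : φ (t + h) ≤ φ t - q * (Λ * ℓ * h) ^ 2 / 52 := by linarith only [hmono', hfin]
  subst hφ
  exact key

end Solution

end Summit.NavierStokesRegularity.NavierStokesRegularity.Theorems.SubOnsagerCeiling

end
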